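import Mathlib
import Summits.Ventures.HodgeRepro.Tier4.Line4.TailSeesaw
import Summits.Ventures.HodgeRepro.Tier4.Line4.ArchApproxGlue
import Summits.Ventures.HodgeRepro.Tier4.Common.CompactUnimodular

/-!
# Tier4/Line4/TailSeesawArch — C-L4-7B-ASSEMBLY, the archimedean test by name: `harch` and the test `e` of record
discharged through L1-p1's C-L4-ARCHAPPROX (`exists_infFactor_of_isArchCoeff`), the (7b) census shrinks to the
per-`(finf, e)` displays (S-SPARSE) and `ChainInputs`

Blind re-derivation cell `pub-hodge-repro`, Tier 4 «prove the step» (README §9–§10), seat t4-L2-p2 (gen 5; plan-4 g6's cut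
S15841, the refinement of TailSeesaw's residual item (10)).  Tree path
`lean/Summits/Ventures/HodgeRepro/Tier4/Line4/TailSeesawArch.lean`.  Imports this seat's `Line4/TailSeesaw`
(`tailForArch_body_of_pieces`), L1-p1's `Line4/ArchApproxGlue` (`exists_infFactor_of_isArchCoeff`: from `IsArchCoeff`
and the K-type data `KTypeData`, an `N`-independent right-`(T′_w, −e′)`-equivariant archimedean test `e` with
`archFactor (finf ⋆ e) γ₀ ≠ 0`) and typer-2's `Common/CompactUnimodular` (`isMulRightInvariant_of_compactSpace`).
Mathlib-level; no literature; no `def`.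

**`tailForArch_body_of_pieces_archApprox`**: `tailForArch_body_of_pieces` with the per-coefficient package `hdisp` split —
the test `e`, its equivariance and `harch` come from ARCHAPPROX by name (`IsArchCoeffD.toIsArchCoeff`, the K-type data `D`,
the right invariance of `νinf′` on the compact `T′_∞`), and what remains displayed is, for EVERY admissible pair `(finf, e)`
(decaying coefficient, equivariant test with `harch`): a sparsity scale `gth` with (S-SPARSE) `hR` along `p^M`, and
`ChainInputs` at every level.  The (7b) census at this layer = TailSeesaw's items (1)–(9) + the K-type data `D`
(the skeleton's `l4_kTypeData`, PROVED there) + this `hdisp'`.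

Nothing here says anything about the status of the Hodge conjecture for CM abelian varieties, which is NOT proved
(HC_CM is NOT proved by anyone in this repository).
-/

set_option autoImplicit false

noncomputable section

namespace Summit.Ventures.HodgeRepro.Tier4.Line4

open Matrix MeasureTheory Topology Filter NumberField IsDedekindDomain Summit.Ventures.HodgeRepro.Tier4
  Summit.Ventures.HodgeRepro.Tier4.Common Summit.Ventures.HodgeRepro.Tier4.Line1
  Summit.Ventures.HodgeRepro.Tier4.Line1.RTF Summit.Ventures.HodgeRepro.Tier4.Line4.L1Class

open scoped NumberField NNReal ENNReal Pointwise Matrix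

section Arch

variable {k : Type} [Field k] [NumberField k] (W : PlaneData k) [MeasurableSpace (GA W)] [BorelSpace (GA W)]
  (R : RTFData W) (μ : Measure (GA W)) [μ.IsHaarMeasure] [R.μT.IsHaarMeasure] [R.μT'.IsHaarMeasure]
  (DG : Set (GA W)) (fdG : IsFundamentalDomain (rationalPoints W) DG μ) (compG : IsCompact (closure DG))
  (compT : IsCompact (closure R.DT)) (compT' : IsCompact (closure R.DT'))

/-- **The body of `TailForArch'''` with the archimedean test by name**: the residual per-coefficient package is
(S-SPARSE) + `ChainInputs` for every admissible `(finf, e)`. -/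
theorem tailForArch_body_of_pieces_archApprox [MeasurableMul (torusT W)] [MeasurableMul (torusT' W)]
    (hRH : R.IsHaar)
    (hc : Continuous R.chi) (hu : ∀ a, ‖R.chi a‖ = 1) (hc' : Continuous R.chi') (hu' : ∀ a, ‖R.chi' a‖ = 1)
    (q : QuadData k) (g g' : Matrix (Fin 4) (Fin 4) k) (w₀ : InfinitePlace k) (eP eM eP' eM' : InfinitePlace k → ℤ)
    (D : KTypeData W R q g g' eP eM eP' eM')
    (hdet : W.B.det ≠ 0) (hgen : IsGenuineRow W)
    (γ₀ : rationalPoints W) (hlin : IsLinRegular W γ₀)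
    (νinf : Measure (torusInf W)) [νinf.IsHaarMeasure] [CompactSpace (torusInf W)]
    (νf : Measure (torusFin W)) [νf.IsHaarMeasure]
    (c : ℝ≥0) (hc0 : 0 < c) (hcμ : R.μT = c • Measure.map (torusSplit W).symm (νinf.prod νf))
    (νinf' : Measure (torusInf' W)) [νinf'.IsHaarMeasure] [CompactSpace (torusInf' W)]
    (νf' : Measure (torusFin' W)) [νf'.IsHaarMeasure]
    (c' : ℝ≥0) (hc0' : 0 < c') (hcμ' : R.μT' = c' • Measure.map (torusSplit' W).symm (νinf'.prod νf'))
    (DZf : Set (torusFin W)) (hDZf : MeasurableSet DZf) (hfd : IsFundamentalDomain (centreFin W) DZf νf)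
    (hDZc : ∀ C : Set (torusFin W), IsCompact C → IsCompact (closure (DZf ∩ (C * (ZfIn W : Set (torusFin W))))))
    (μinf : Measure (infinitePart W)) [μinf.IsHaarMeasure] (μ₀ : Measure (finitePart W)) [μ₀.IsHaarMeasure]
    (c₀ : ℝ≥0) (hc₀ : 0 < c₀) (hcμ₀ : μ = c₀ • Measure.map (gaSplit W).symm (μinf.prod μ₀))
    (p : ℕ) (hp : p.Prime)
    (hγ₀ : ∀ v : HeightOneSpectrum (𝓞 k), natSize k v p < 1 → ∀ i j : Fin 4,
      Valued.v (finPart k (GA.mat W (γ₀ : GA W) i j) v) ≤ 1 ∧ Valued.v (finPart k (GA.mat W (γ₀ : GA W)⁻¹ i j) v) ≤ 1)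
    (u : ℕ → ℝ≥0∞) (κ : ℝ≥0∞) (hκ : κ ≠ ⊤)
    (hproj : ∀ (M : ℕ) (γ : GA W), νf (finTf W '' closure R.DT ∩ projSet W (γ₀ : GA W) (p ^ M) γ) ≤ κ * u M)
    (M₃ : ℝ≥0∞) (hM₃ : M₃ ≠ ⊤)
    (hcur : ∀ M, u M ≤ M₃ * νf (((ZfIn W : Set (torusFin W)) ∩ levelTf W 1) * levelTf W (p ^ M)))
    (hcount : SublevelCount₀ W (Setting.ofAdelicData W R μ DG fdG compG compT compT'))
    (hnv : ∃ δ : ℝ, 0 < δ ∧ ∃ M₀ : ℕ, ∀ M ≥ M₀,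
      δ * (suppMeasure W νf νf' (γ₀ : GA W) DZf (p ^ M) (γ₀ : GA W)).toReal ≤
        ‖∫ b in DZf, R.chi b * innerFin W R (levelDC W (γ₀ : GA W) (p ^ M)) (γ₀ : GA W) νf' b ∂νf‖)
    -- (S-SPARSE) and `ChainInputs` for every admissible `(finf, e)`
    (hdisp : ∀ finf : GA W → ℂ,
      IsArchCoeffD W (Setting.ofAdelicData W R μ DG fdG compG compT compT') R q g g' w₀ eP eM eP' eM'
        (γ₀ : GA W) νinf νinf' finf →
      ∀ e : GA W → ℂ, IsInfFactor W e →
        (∀ (w : InfinitePlace k) (κ : GA W), κ ∈ localTorusAt' W w → ∀ x,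
          e (x * κ) = weightAt' W q w g g' 0 κ ^ (-eP' w) * weightAt' W q w g g' 1 κ ^ (-eM' w) * e x) →
        L1Class.archFactor W R (convInf W μinf finf e) (γ₀ : GA W) νinf νinf' ≠ 0 →
        (∃ gth : ℕ → ℝ, Tendsto gth atTop atTop ∧
          ∀ (M : ℕ) (γ : (Setting.ofAdelicData W R μ DG fdG compG compT compT').Gk),
            (Setting.ofAdelicData W R μ DG fdG compG compT compT').orbitOf γ ∉
              ({(Setting.ofAdelicData W R μ DG fdG compG compT compT').orbitOf γ₀} :
                Finset (Setting.ofAdelicData W R μ DG fdG compG compT compT').Orbit) →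
            (∃ t ∈ R.DT, ∃ t' ∈ R.DT',
              (Setting.ofAdelicData W R μ DG fdG compG compT compT').conv
                (prodFn W finf (ffinMu W μ₀ (γ₀ : GA W) (p ^ M))) (testNat W e (p ^ M))
                ((t : GA W)⁻¹ * γ * (t' : GA W)) ≠ 0) →
            gth (p ^ M) ≤ archDist W (γ : GA W)) ∧
        ∀ M : ℕ, ChainInputs W R γ₀ νinf νf νinf' νf' DZf
          ((Setting.ofAdelicData W R μ DG fdG compG compT compT').conv
            (prodFn W finf (ffinMu W μ₀ (γ₀ : GA W) (p ^ M))) (testNat W e (p ^ M)))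
          (fun x => (c₀ : ℂ) * convInf W μinf finf e x) (levelDC W (γ₀ : GA W) (p ^ M))) :
    ∀ finf : GA W → ℂ,
      IsArchCoeffD W (Setting.ofAdelicData W R μ DG fdG compG compT compT') R q g g' w₀ eP eM eP' eM'
        (γ₀ : GA W) νinf νinf' finf →
      ∃ lev : ℕ → ℕ, (∀ n, lev n ≠ 0) ∧
      ∃ ffin f₂ : ℕ → GA W → ℂ, TailFamily' W q g g' eP' eM' (γ₀ : GA W) ffin f₂ ∧
        ∃ E : Finset (Setting.ofAdelicData W R μ DG fdG compG compT compT').Orbit,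
          (Setting.ofAdelicData W R μ DG fdG compG compT compT').orbitOf γ₀ ∈ E ∧
          FibreDominatedFrom (Setting.ofAdelicData W R μ DG fdG compG compT compT') R.chi R.chi' E
            (fun n => (Setting.ofAdelicData W R μ DG fdG compG compT compT').conv
              (prodFn W finf (ffin (lev n))) (f₂ (lev n))) := by
  haveI : νinf'.IsMulRightInvariant := isMulRightInvariant_of_compactSpace νinf'
  refine tailForArch_body_of_pieces W R μ DG fdG compG compT compT' hRH hc hu hc' hu' q g g' w₀ eP eM eP' eM' hdet
    hgen γ₀ hlin νinf νf c hc0 hcμ νinf' νf' c' hc0' hcμ' DZf hDZf hfd hDZc μinf μ₀ c₀ hc₀ hcμ₀ p hp hγ₀ u κ hκ hproj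
    M₃ hM₃ hcur hcount hnv ?_
  intro finf hfinf
  obtain ⟨e, he, hequiv, harch⟩ := exists_infFactor_of_isArchCoeff W
    (Setting.ofAdelicData W R μ DG fdG compG compT compT') R q g g' w₀ eP eM eP' eM' (γ₀ : GA W) νinf νinf'
    hfinf.toIsArchCoeff D μinf hc hu hc' hu'
  exact ⟨e, he, hequiv, harch, hdisp finf hfinf e he hequiv harch⟩

end Arch

end Summit.Ventures.HodgeRepro.Tier4.Line4

end
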